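import Literature.Analysis.FluidPDE.TaoAveragedCascadeHolds
import HarnessLib

/-!
# Barrier: the averaged Navier–Stokes blow-up survives every supercritical fractional dissipation `(-Δ)^α`, `0 < α < 5/4` (Coiculescu 2023, Thm. 4.2; Tao 2016, footnote to §1.2)

Barrier catalogue entry for `NavierStokesRegularity` (D-0021). T. Tao's Theorem 1.5 (catalogue
entry `TaoAveragedBlowup`, in-tree theorem `Literature.Analysis.FluidPDE.Tao2016.averagedNS_blowup_holds`)
exhibits a symmetric averaged Euler bilinear operator `B̃` with the cancellation property and a
Schwartz divergence-free datum without global mild `H¹⁰_df` solution of `∂ₜu = Δu + B̃(u,u)`.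
Tao remarks (footnote to §1.2, p. 8 of the held arXiv text): *"Indeed, our arguments permit one
to add any supercritical hyperdissipation `(-Δ)^α`, `α < 5/4`, to the equation (1.9) while
still obtaining blowup for certain choices of initial data, although for sake of exposition we
will only discuss the classical `α = 1` case here."* M. P. Coiculescu (arXiv:2307.15986, 2023)
prints this as a theorem at the level of Tao's local cascade operators — his **Theorem 4.2**,
for every dyadic parameter `1 < λ < 2` and every `0 < α < 5/4` — and, through Tao's Theorem 3.2
(every local cascade operator is an averaged Euler bilinear operator; Coiculescu's Thm. 4.8), as
the first clause of his **Corollary 4.9 / Theorem 1.2** for averaged operators. This file vendors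
Theorem 4.2 **as printed**, over the tree's accepted rendering of Tao's objects
(`Literature/Analysis/FluidPDE/TaoAveragedSobolev.lean`, `…/TaoAveragedCascade.lean`: `L2C`,
`MemH10df`, `pairing`, `schwartzL2`, `IsLocalCascadeForm`, `AveragingDatum`), adding only the
fractional heat propagator `e^{-τ(-Δ)^α}` on `L²(ℝ³; ℂ³)` (`fracHeat`, the Fourier multiplier
`exp(-τ(4π²|ξ|²)^α)` in Tao's normalisation, so that `α = 1` is *definitionally the same symbol*
as the accepted `heat`, `fracHeat_one`) and the corresponding mild formulation
(`IsFracMildSolutionFor`, Coiculescu's display (mild) of §4.1, "`u(t) = e^{-t(-Δ)^α}u₀ + ∫₀ᵗ e^{(s-t)(-Δ)^α} C(u(s),u(s)) ds`").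

## What is printed (M. P. Coiculescu, *Partial regularity and blowup for an averaged three-dimensional Navier–Stokes equation*, arXiv:2307.15986 (2023), held as `paper:arxiv-2307.15986`; chunk/line locators of that text)

* §4.1, p. 13 (definitions, verbatim up to notation): "A basic local cascade operator is a
  bilinear operator `C : H¹⁰_df(ℝ³) × H¹⁰_df(ℝ³) → H¹⁰_df(ℝ³)*` defined via duality by
  `⟨C(u,v), w⟩ = ∑_{n ∈ ℤ} λ^{5n/2} ⟨u, ψ_{1,n}⟩⟨v, ψ_{2,n}⟩⟨w, ψ_{3,n}⟩` where
  `ψ_{i,n}(x) = λ^{3n/2}ψᵢ(λⁿx)` and `ψᵢ` is a Schwartz vector field whose Fourier transform is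
  compactly supported within a small annulus around the unit sphere in `ℝ³`. We also define a
  local cascade operator to be a finite linear combination of basic local cascade operators.
  Lastly, we call a basic local cascade operator a zero-momentum basic local cascade operator if
  its constituent Schwartz vector fields satisfy `∫_{ℝ³} ψᵢ dx = 0`." With `λ = 1 + ε₀` these are
  Tao's Definition 3.1 objects, accepted in the tree as `Tao2016.IsLocalCascadeForm ε₀` (profiles
  with Fourier support in the annulus `{1 - 2ε₀ ≤ |ξ| ≤ 1 + 2ε₀}`; Coiculescu's witness uses balls
  in `{1 < |ξ| ≤ (λ+1)/2}` ⊂ that annulus, p. 13 L60).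
* §4.1, **Theorem 4.2** (p. 13 L43–57, verbatim): "Let `1 < λ < 2` and `0 < α < 5/4` be
  arbitrary. Then there exists a zero-momentum symmetric local cascade operator `C` and a
  Schwartz divergence-free vector field `u₀` such that the cancellation identity holds
  `⟨C(u,u), u⟩ = 0` for all `u ∈ H¹⁰_df(ℝ³)` and there does not exist any global mild solution
  `u : [0,∞) → H¹⁰_df(ℝ³)` to the initial value problem `∂ₜu + (-Δ)^α u + C(u,u) = 0`,
  `u(·, t = 0) = u₀`", a mild solution being (p. 14 L4–6, display (mild))
  "`u(t) = e^{-t(-Δ)^α}u₀ + ∫₀ᵗ e^{(s-t)(-Δ)^α} C(u(s),u(s)) ds`" (the sign of `C` in the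
  differential form is immaterial: the class of symmetric local cascade operators with
  cancellation is closed under `C ↦ -C`; the Duhamel display is what is transcribed).
* Its printed proof (p. 14 L51): "the aforementioned concentration of energy occurs on timescales
  of order `t_{n+1} - t_n = λ^{(-5/2+O(ε₀))n}` which are significantly smaller than the dissipation
  time scale which (for fractional dissipation of order `α`) is `λ^{2αn}` by Lemma 4.3. Obviously
  this can occur so long as `α < 5/4`. Since Tao never uses any assumption about the integral of
  the functions `ψ_{i,n}`, one can follow through Tao's construction and get blowup for a
  zero-momentum cascade operator for a pseudodifferential equation with hyperdissipation with
  `α < 5/4`." — i.e. Tao's §§4–6 with `λ^{2n}` replaced by `λ^{2αn}` in the error terms of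
  Lemma 4.1 (his Lemma 4.3, p. 13 L87, the equations of motion with error `O(λ^{2αn}E_{i,n}^{1/2})`, from the estimate p. 14 L32: `|⟨-(-Δ)^α u_{i,n}, ψ_{i,n}⟩| ≤ K E_{i,n}^{1/2} λ^{2αn}`).
* §4.2, **Theorem 4.8** (p. 16 L5–6) = Tao 2016 Thm. 3.2: "Let `λ₀ > 1` be an absolute constant
  sufficiently close to `1`. Then every local cascade operator (not necessarily zero-momentum) is
  an averaged Euler bilinear operator" (in the tree: `Tao2016.localCascade_isAveraged_holds`);
  **Corollary 4.9** (p. 16 L13) = **Theorem 1.2** (p. 4 L28–41): "Let `3/4 < α < 5/4` be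
  arbitrary. There exists a symmetric averaged Euler bilinear operator `B` obeying the
  cancellation identity for `u ∈ H¹⁰_df(ℝ³)` and a Schwartz divergence-free initial vector field
  so that there is no global-in-time solution to the associated `α`-dissipative pseudodifferential
  equation. Moreover if `T` is the time of first blowup, then the closed set `S_T` has Hausdorff
  dimension at most `5 - 4α`", where `S_T := {x ∈ ℝ³ : ∀ r > 0, u ∉ L^∞_t C^∞_x(𝒫_r(x,T))}`
  (p. 4 L24–26) and the dimension bound is his general partial-regularity Theorem 1.3 for
  "amenable" bilinear operators (Def. 1, p. 4), which needs `α > 3/4`.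
* T. Tao, J. Amer. Math. Soc. 29 (2016), footnote to §1.2 (held arXiv text p. 8), quoted above.

## Formal content

* `fracHeatSymbol`, `fracHeat`, `IsFracMildSolutionFor` — the propagator `e^{-τ(-Δ)^α}` on
  `L²(ℝ³; ℂ³)` and mild `H¹⁰_df` solutions of `∂ₜu = -(-Δ)^α u + T(u,u)` in the accepted duality
  form (the accepted `Tao2016.IsMildSolutionFor` with `e^{τΔ}` replaced by `e^{-τ(-Δ)^α}`;
  `isFracMildSolutionFor_one_iff`: at `α = 1` the two notions coincide);
* `IsZeroMomentumLocalCascadeForm ε₀ T` — the accepted `Tao2016.IsLocalCascadeForm ε₀ T` with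
  the printed extra clause `∫ ψ_{j,i} = 0` on the profiles (it implies `IsLocalCascadeForm`);
* the catalogue entry `HyperdissipativeAveragedBlowup` — **Theorem 4.2 as printed**, the ONE named
  fact of this file (its proof is Tao's §§4–6, ≈ 10⁴ lines in the tree, re-run with the
  dissipation scale `λ^{2αn}`; the tree's transcription `TaoCascade.CascadeODESolution` fixes the
  exponent `2`, so the discharge is not attempted here — size XL), with the structured barrier
  block;
* PROVED consequences: `HyperdissipativeAveragedBlowup.averaged` — for every `0 < α < 5/4` a
  symmetric averaging datum `𝒜` (Tao (1.12)–(1.13)) with cancellation and a Schwartz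
  divergence-free `u₀` without global mild solution of `∂ₜu = -(-Δ)^α u + B̃_𝒜(u,u)` (Theorem 4.2 +
  the in-tree Theorem 3.2, exactly as Tao assembles Thm. 1.5 from Thms. 3.2–3.3,
  `Tao2016.averagedNS_blowup_of_cascade`); `HyperdissipativeAveragedBlowup.corollary49` — the
  first clause of Cor. 4.9 / Thm. 1.2 on its printed range `3/4 < α < 5/4`;
  `HyperdissipativeAveragedBlowup.localCascade_blowup` and `….averagedNS_blowup` — at `α = 1` the
  entry gives back Tao's Theorem 3.3 and Theorem 1.5 as stated in the tree (consistency of the new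
  vocabulary with the accepted one).

Not transcribed: the second clause of Cor. 4.9 / Thm. 1.2 (`dim_H S_T ≤ 5 - 4α` for the blow-up
solution) and the partial-regularity Theorem 1.3 — see `scope_caveats`.

## References

* M. P. Coiculescu, *Partial regularity and blowup for an averaged three-dimensional
  Navier–Stokes equation*, arXiv:2307.15986 (2023). [`Coiculescu2023`]
* T. Tao, *Finite time blowup for an averaged three-dimensional Navier–Stokes equation*,
  J. Amer. Math. Soc. 29 (2016), 601–674; arXiv:1402.0290. [`Tao2016AveragedNS`]
* N. H. Katz, N. Pavlović, *A cheap Caffarelli–Kohn–Nirenberg inequality for the Navier–Stokes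
  equation with hyper-dissipation*, Geom. Funct. Anal. 12 (2002), 355–379. [`KatzPavlovic2002`]
-/

noncomputable section

open MeasureTheory Set Filter FourierTransform
open scoped ENNReal NNReal SchwartzMap

namespace Literature.Barriers.NavierStokesRegularity

open Literature.Analysis.FluidPDE Literature.Analysis.FluidPDE.Tao2016

/-! ### The fractional heat propagator `e^{-τ(-Δ)^α}` on `L²(ℝ³; ℂ³)` -/

/-- The symbol `exp(-τ (4π²|ξ|²)^α)` of `e^{-τ(-Δ)^α}`, `τ ≥ 0`, in Tao's Fourier normalisation
(`Δ ↔ -4π²|ξ|²`, accepted `Tao2016.heatSymbol`), frozen at its `τ = 0` value for `τ < 0` (the same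
documented junk extension as `heatSymbol`). At `α = 1` it is `heatSymbol` (`fracHeatSymbol_one`).
[cite: Coiculescu2023, §4.1 display (mild) p. 14] -/
def fracHeatSymbol (α τ : ℝ) (ξ : EuclideanSpace ℝ (Fin 3)) : ℂ :=
  ((Real.exp (-(max τ 0 * (4 * Real.pi ^ 2 * ‖ξ‖ ^ 2) ^ α)) : ℝ) : ℂ)

/-- At `α = 1` the fractional heat symbol is the heat symbol. [folklore] -/
theorem fracHeatSymbol_one (τ : ℝ) : fracHeatSymbol 1 τ = heatSymbol τ := by
  funext ξ
  simp only [fracHeatSymbol, heatSymbol, Real.rpow_one]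
  ring_nf

/-- The fractional heat symbol is measurable. [folklore] -/
theorem measurable_fracHeatSymbol (α τ : ℝ) : Measurable (fracHeatSymbol α τ) := by
  unfold fracHeatSymbol
  refine Complex.measurable_ofReal.comp (Real.measurable_exp.comp ?_)
  exact ((measurable_const.mul (measurable_norm.pow_const 2)).pow_const α).const_mul _ |>.neg

/-- The fractional heat symbol is bounded by `1`. [folklore] -/
theorem norm_fracHeatSymbol_le (α τ : ℝ) (ξ : EuclideanSpace ℝ (Fin 3)) :
    ‖fracHeatSymbol α τ ξ‖ ≤ 1 := by
  unfold fracHeatSymbol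
  rw [Complex.norm_real, Real.norm_eq_abs, abs_of_pos (Real.exp_pos _), Real.exp_le_one_iff,
    neg_nonpos]
  exact mul_nonneg (le_max_right _ _) (Real.rpow_nonneg (by positivity) _)

/-- The fractional heat symbol is an `L^∞` symbol. [folklore] -/
theorem memLp_top_fracHeatSymbol (α τ : ℝ) :
    MemLp (fracHeatSymbol α τ) ∞ (volume : Measure (EuclideanSpace ℝ (Fin 3))) :=
  memLp_top_of_bound (measurable_fracHeatSymbol α τ).aestronglyMeasurable 1
    (Eventually.of_forall (norm_fracHeatSymbol_le α τ))

/-- The **fractional heat propagator** `e^{-τ(-Δ)^α}` on `L²(ℝ³; ℂ³)`, `τ ≥ 0`, as the accepted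
Fourier multiplier (`Tao2016.fourierMultiplier`) with symbol `exp(-τ(4π²|ξ|²)^α)`; for `τ < 0` it
is the identity (junk, as for `Tao2016.heat`). [cite: Coiculescu2023, §4.1 display (mild) p. 14] -/
def fracHeat (α τ : ℝ) (u : L2C) : L2C :=
  fourierMultiplier ((memLp_top_fracHeatSymbol α τ).toLp _) u

/-- At `α = 1`, `e^{-τ(-Δ)^1} = e^{τΔ}` is the accepted heat propagator. [folklore] -/
theorem fracHeat_one (τ : ℝ) (u : L2C) : fracHeat 1 τ u = heat τ u := by
  unfold fracHeat heat
  congr 1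
  exact MemLp.toLp_congr _ _ (Eventually.of_forall fun ξ => by rw [fracHeatSymbol_one])

/-- The Fourier transform of `e^{-τ(-Δ)^α}u` is `exp(-τ(4π²|ξ|²)^α) û` (a.e.). [folklore] -/
theorem fourierFn_fracHeat (α τ : ℝ) (u : L2C) :
    fourierFn (fracHeat α τ u) =ᵐ[volume] fun ξ => fracHeatSymbol α τ ξ • fourierFn u ξ := by
  unfold fracHeat
  filter_upwards [fourierFn_fourierMultiplier ((memLp_top_fracHeatSymbol α τ).toLp _) u,
    MemLp.coeFn_toLp (memLp_top_fracHeatSymbol α τ)] with ξ h1 h2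
  rw [h1, h2]

/-- The fractional heat symbol is bounded by `1` (`ℝ≥0∞` form). [folklore] -/
theorem enorm_fracHeatSymbol_le (α τ : ℝ) (ξ : EuclideanSpace ℝ (Fin 3)) :
    ‖fracHeatSymbol α τ ξ‖ₑ ≤ 1 := by
  rw [← ofReal_norm, ← ENNReal.ofReal_one]
  exact ENNReal.ofReal_le_ofReal (norm_fracHeatSymbol_le α τ ξ)

/-- **`e^{-τ(-Δ)^α}` is a contraction for every Sobolev norm `H^s`.** [folklore] -/
theorem eFourierSobolevNorm_fracHeat_le (s α τ : ℝ) (u : L2C) :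
    Literature.Analysis.FunctionSpaces.eFourierSobolevNorm s (fracHeat α τ u) ≤
      Literature.Analysis.FunctionSpaces.eFourierSobolevNorm s u := by
  unfold Literature.Analysis.FunctionSpaces.eFourierSobolevNorm
  refine ENNReal.rpow_le_rpow ?_ (by norm_num)
  refine lintegral_mono_ae ?_
  filter_upwards [fourierFn_fracHeat α τ u] with ξ hξ
  change _ * ‖fourierFn (fracHeat α τ u) ξ‖ₑ ^ 2 ≤ _ * ‖fourierFn u ξ‖ₑ ^ 2
  rw [hξ, enorm_smul]
  gcongr
  exact mul_le_of_le_one_left zero_le (enorm_fracHeatSymbol_le α τ ξ)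

/-- **`e^{-τ(-Δ)^α}` preserves divergence-freeness** (a scalar Fourier multiplier commutes with
`ξ ·`). [folklore] -/
theorem isFourierDivFree_fracHeat {u : L2C} (hu : IsFourierDivFree u) (α τ : ℝ) :
    IsFourierDivFree (fracHeat α τ u) := by
  unfold IsFourierDivFree at *
  filter_upwards [hu, fourierFn_fracHeat α τ u] with ξ h1 h2
  rw [h2, cdot_smul_right, h1, mul_zero]

/-- `e^{-τ(-Δ)^α}` preserves the complexified class `H¹⁰_df ⊗ ℂ` (accepted `Tao2016.MemH10dfC`). [folklore] -/
theorem memH10dfC_fracHeat {u : L2C} (h : MemH10dfC u) (α τ : ℝ) :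
    MemH10dfC (fracHeat α τ u) :=
  ⟨(eFourierSobolevNorm_fracHeat_le 10 α τ u).trans_lt h.1, isFourierDivFree_fracHeat h.2 α τ⟩

/-! ### Mild solutions with fractional dissipation -/

/-- **Mild `H¹⁰` solutions of `∂ₜu = -(-Δ)^α u + T(u,u)`, `u(0) = u₀`, on a time set `I ∋ 0`**,
for a bilinear operator `T : H¹⁰_df × H¹⁰_df → (H¹⁰_df)*` given by its duality form
(Coiculescu 2023, display (mild), p. 14: "`u(t) = e^{-t(-Δ)^α}u₀ + ∫₀ᵗ e^{(s-t)(-Δ)^α} C(u(s),u(s)) ds`";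
for `α = 1` Tao 2016 (1.15)/(3.3)): the accepted `Tao2016.IsMildSolutionFor` with the heat
propagator replaced by `fracHeat α` — a continuous map `u : I → H¹⁰_df(ℝ³)` with
`⟨u(t), w⟩ = ⟨e^{-t(-Δ)^α}u₀, w⟩ + ∫₀ᵗ ⟨T(u(s),u(s)), e^{-(t-s)(-Δ)^α} w⟩ ds` for all `t ∈ I` and
`w ∈ H¹⁰_df` (the self-transposed propagator moved onto the test field, as in the accepted
rendering of (1.15)). [cite: Coiculescu2023, §4.1 display (mild) p. 14] -/
def IsFracMildSolutionFor (α : ℝ) (T : L2C → L2C → L2C → ℂ) (u₀ : L2C) (I : Set ℝ)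
    (u : ℝ → L2C) : Prop :=
  (∀ t ∈ I, MemH10df (u t)) ∧ ContinuousInH10On I u ∧
    ∀ t ∈ I, ∀ w, MemH10df w →
      pairing (u t) w =
        pairing (fracHeat α t u₀) w + ∫ s in (0 : ℝ)..t, T (u s) (u s) (fracHeat α (t - s) w)

/-- At `α = 1` the fractional mild formulation is the accepted one (`Tao2016.IsMildSolutionFor`,
Tao (1.15)/(3.3)). [folklore] -/
theorem isFracMildSolutionFor_one_iff (T : L2C → L2C → L2C → ℂ) (u₀ : L2C) (I : Set ℝ)
    (u : ℝ → L2C) : IsFracMildSolutionFor 1 T u₀ I u ↔ IsMildSolutionFor T u₀ I u := by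
  simp only [IsFracMildSolutionFor, IsMildSolutionFor, fracHeat_one]

/-! ### Zero-momentum local cascade operators (Coiculescu §4.1) -/

/-- The duality form `T = ⟨C(·,·), ·⟩` **is a zero-momentum local cascade operator with dyadic
scale parameter `ε₀`** (Coiculescu 2023, §4.1 p. 13, with `λ = 1 + ε₀`): a finite real linear
combination of basic local cascade operators (accepted `Tao2016.basicCascadeForm`) whose profiles
`ψ_{j,i}` are Schwartz with Fourier transforms supported in the annulus
`{1 - 2ε₀ ≤ |ξ| ≤ 1 + 2ε₀}` (accepted `Tao2016.HasAnnularFourierSupport`) **and have zero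
momentum, `∫_{ℝ³} ψ_{j,i} dx = 0`** — the accepted `Tao2016.IsLocalCascadeForm ε₀ T` with the
printed extra clause (for `ε₀ < 1/2` the clause is implied by the annular Fourier support, since
`ψ̂(0) = ∫ψ`; it is recorded because the source prints it). The defining identity is recorded for
`u, v ∈ H¹⁰_df` and `w ∈ H¹⁰_df ⊗ ℂ`, as in the accepted definition. [cite: Coiculescu2023, §4.1 p. 13] -/
def IsZeroMomentumLocalCascadeForm (ε₀ : ℝ) (T : L2C → L2C → L2C → ℂ) : Prop :=
  ∃ (k : ℕ) (c : Fin k → ℝ) (ψ : Fin k → Fin 3 → 𝓢(EuclideanSpace ℝ (Fin 3), EuclideanSpace ℝ (Fin 3))),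
    (∀ j i, HasAnnularFourierSupport ε₀ (ψ j i)) ∧
      (∀ j i, ∫ x, (ψ j i) x = 0) ∧
        ∀ u v w, MemH10df u → MemH10df v → MemH10dfC w →
          T u v w = ∑ j, (c j : ℂ) * basicCascadeForm ε₀ (ψ j 0) (ψ j 1) (ψ j 2) u v w

/-- A zero-momentum local cascade form is a local cascade form (drop the momentum clause). [cite: Coiculescu2023, §4.1 p. 13] -/
theorem IsZeroMomentumLocalCascadeForm.isLocalCascadeForm {ε₀ : ℝ} {T : L2C → L2C → L2C → ℂ}
    (h : IsZeroMomentumLocalCascadeForm ε₀ T) : IsLocalCascadeForm ε₀ T := by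
  obtain ⟨k, c, ψ, hψ, -, hT⟩ := h
  exact ⟨k, c, ψ, hψ, hT⟩

/-! ### The catalogue entry: Theorem 4.2 as a named fact -/

/-- **Barrier (Coiculescu 2023, Thm. 4.2; Tao 2016, footnote to §1.2): the averaged / local-cascade
blow-up of Tao's Theorem 1.5 persists when `Δ` is replaced by `-(-Δ)^α` for ANY `0 < α < 5/4` —
right up to J.-L. Lions' exponent.** For every dyadic parameter `0 < ε₀ < 1` and every
`0 < α < 5/4` there exist a zero-momentum symmetric local cascade operator `C` with the
cancellation identity `⟨C(u,u),u⟩ = 0` on `H¹⁰_df(ℝ³)` and a Schwartz divergence-free `u₀` such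
that `u(t) = e^{-t(-Δ)^α}u₀ + ∫₀ᵗ e^{-(t-s)(-Δ)^α} C(u(s),u(s)) ds` has no global solution
`u : [0,∞) → H¹⁰_df(ℝ³)` (the Lean body; rendering notes in the next paragraph); by
the in-tree Theorem 3.2 of Tao (`Tao2016.localCascade_isAveraged_holds`) it yields the averaged-operator
form for every `0 < α < 5/4` (`HyperdissipativeAveragedBlowup.averaged`, proved below), whose
restriction to `3/4 < α < 5/4` is the first clause of Coiculescu's Cor. 4.9 / Thm. 1.2
(`HyperdissipativeAveragedBlowup.corollary49`), and at `α = 1` it returns Tao's Theorems 3.3 and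
1.5 as stated in the tree (`….localCascade_blowup`, `….averagedNS_blowup`).

RENDERING of **Theorem 4.2 as printed** (§4.1, p. 13): *Let `1 < λ < 2` and `0 < α < 5/4` be
arbitrary. Then there exists a zero-momentum symmetric local cascade operator `C` and a Schwartz
divergence-free vector field `u₀` such that the cancellation identity holds, `⟨C(u,u), u⟩ = 0` for
all `u ∈ H¹⁰_df(ℝ³)`, and there does not exist any global mild solution `u : [0,∞) → H¹⁰_df(ℝ³)`
to the initial value problem `∂ₜu + (-Δ)^α u + C(u,u) = 0`, `u(·,0) = u₀`* — mild in the sense of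
his display (mild), p. 14: `u(t) = e^{-t(-Δ)^α}u₀ + ∫₀ᵗ e^{(s-t)(-Δ)^α} C(u(s),u(s)) ds`
(`IsFracMildSolutionFor α`). Here `λ = 1 + ε₀` with `0 < ε₀ < 1`; the operator is recorded
through its duality form `T` (accepted rendering of Tao's Def. 3.1, with the printed zero-momentum
clause: `IsZeroMomentumLocalCascadeForm`); "symmetric" and the cancellation identity on `H¹⁰_df`
are written exactly as in the accepted `Tao2016.localCascade_blowup` (Tao's Thm. 3.3, the case
`α = 1`, which this entry extends and, at `α = 1`, implies). Printed proof: Tao 2016 §§4–6 with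
the dissipation scale `λ^{2αn}` in place of `λ^{2n}` (his Lemma 4.3 and the paragraph p. 14 L51,
quoted in the module docstring); asserted independently by Tao (2016, footnote to §1.2). Not
proved here: the tree's transcription of Tao's §§4–6 (`TaoCascade.CascadeODESolution`,
`equationsOfMotion`, `odeBlowup`, ≈ 10⁴ lines) fixes the exponent `2`. A `Prop`-valued definition,
not asserted; the one named fact of this file.
[cite: Coiculescu2023, §4.1 Thm. 4.2 (p. 13) and §4.2 Cor. 4.9 (p. 16)]

BARRIER (structured block, D-0021):
technique_class: dissipation-exponent-insensitive energy-identity harmonic-analysis energy-methods function-space-estimates abstract-bilinear-estimates supercritical-hyperdissipation hypodissipation — regularity arguments for `∂ₜu + (-Δ)^α u + B(u,u) + ∇p = 0` that use only the cancellation identity `⟨B(u,u),u⟩ = 0` and function-space estimates of the Euler bilinear form `B` shared by Tao's averaged operators `B̃` (the class of the entry `TaoAveragedBlowup`), for some or all exponents `α < 5/4`.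
blocks: global regularity of the `α`-dissipative (hypo-, `α < 1`, or hyper-, `1 < α < 5/4`) Navier–Stokes system in the mild `H¹⁰_df(ℝ³)` formulation for any single `α < 5/4` by such arguments — in particular any attempt to lower J.-L. Lions' regularity exponent `5/4` (global regularity of true hyperdissipative NS for `α ≥ 5/4`) by an `ε` using only structure shared with `B̃`; and the reading of Tao's machine programme in which a self-replicating cascade "can survive the presence of a supercritical dissipation if the initial scale of the machine is sufficiently small" is a theorem for the averaged equations for every `α < 5/4` [cite: Tao2016AveragedNS, §1.3 p. 11 and §1.2 footnote p. 8] [cite: Coiculescu2023, §4.1 Thm. 4.2].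
because: Thm. 4.2 as printed (and as stated by this entry): for every `1 < λ < 2` and `0 < α < 5/4` a zero-momentum symmetric local cascade operator with cancellation and a Schwartz divergence-free datum admit no global mild `H¹⁰_df` solution of `∂ₜu + (-Δ)^α u + C(u,u) = 0` [cite: Coiculescu2023, §4.1 Thm. 4.2 (p. 13)], because Tao's cascade transfers energy from scale `λ^{-n}` to `λ^{-(n+1)}` in time `λ^{(-5/2+O(ε₀))n}`, shorter than the dissipation time `λ^{-2αn}` exactly when `α < 5/4` [cite: Coiculescu2023, §4.1 p. 14 L51 and Lemma 4.3] [cite: Tao2016AveragedNS, §1.2 footnote p. 8]; every local cascade operator (for `λ` close to `1`) is an averaged Euler bilinear operator in Tao's sense [cite: Tao2016AveragedNS, Thm. 3.2] [cite: Coiculescu2023, §4.2 Thm. 4.8], proved in the tree (`Tao2016.localCascade_isAveraged_holds`), whence the averaged form (`HyperdissipativeAveragedBlowup.averaged`, proved here); since `B̃` obeys the energy identity and inherits the function-space estimates of `B` [cite: Tao2016AveragedNS, §1.1 pp. 6–7], an argument in the blocked class would prove global regularity of the averaged `α`-dissipative equation, which is false for every `α < 5/4`.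
evasions_known: the NS-specific structures listed under the entry `TaoAveragedBlowup` (backward uniqueness / Type-I exclusion [cite: EscauriazaSereginSverak2003, Thms. 1.3–1.4]; slowly varying data [cite: CheminGallagherPaicu2011, main theorem as reported by Tao 2016 §1.1 p. 8]) [cite: Tao2016AveragedNS, §1.1 p. 8]; raising the dissipation to `α ≥ 5/4`, where the true `α`-dissipative system has classical global solutions for smooth decaying data ("it is known … A very short proof of this fact when `α > 5/4` can be found in the introduction of [KP]" [cite: Coiculescu2023, §1 p. 3 L24]; J.-L. Lions 1969 as recorded by the entry `LionsExponentSharpness`), leaves the barrier's range rather than evading it. NOT an evasion: partial regularity — Coiculescu's Thm. 1.3 proves the Katz–Pavlović bound `dim_H S_T ≤ 5 - 4α` (`3/4 < α < 5/4`) for every "amenable" bilinear operator, a class containing both `B` and the blowing-up averaged operator of Thm. 4.2, "one that suggests that improving partial regularity results for the Navier–Stokes equations is not a path to answering the global regularity question, unless one uses more specific structural properties of the Navier–Stokes nonlinearity" [cite: Coiculescu2023, §1 p. 4 L16 and Thms. 1.2–1.3].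
scope_caveats: (i) SOURCE STATUS: arXiv preprint (2023), listed as a preprint by zbMATH on 2026-08-19 (no journal version found); the proof of Thm. 4.2 is printed as an adaptation note ("one can follow through Tao's construction", p. 14 L51) on top of his Lemma 4.3, not line by line; the same statement for hyperdissipation `α < 5/4` is asserted, without proof, in Tao's refereed footnote [cite: Tao2016AveragedNS, §1.2 footnote p. 8] [cite: Coiculescu2023, §4.1 p. 14]; (ii) NOT TRANSCRIBED: the second clause of Cor. 4.9 / Thm. 1.2 (`dim_H S_T ≤ 5 - 4α` for the blow-up solution, `T` its first blow-up time) and the partial-regularity Thm. 1.3 — they need the maximal smooth solution and the parabolic singular set `S_T = {x : ∀ r > 0, u ∉ L^∞_t C^∞_x(𝒫_r(x,T))}`, not typed in the tree's `L²`-class vocabulary; Cor. 4.9 restricts to `α > 3/4` only because of that clause, while Thm. 4.2 (this entry) covers `0 < α < 5/4` [cite: Coiculescu2023, §1 Thm. 1.2 (p. 4) and §4.2 Cor. 4.9 (p. 16)]; (iii) the entry is an existence statement about one constructed operator and datum per `(λ, α)`; its barrier force rests on the informal estimate-inheritance of averaged operators exactly as for `TaoAveragedBlowup` (that entry's `scope_caveats`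 (i)–(ii)) [cite: Tao2016AveragedNS, §1.1 pp. 6–7]; (iv) rendering: Coiculescu's "small annulus around the unit sphere" is recorded as Tao's annulus `{1-2ε₀ ≤ |ξ| ≤ 1+2ε₀}` (accepted `IsLocalCascadeForm`; his witness uses `{1 < |ξ| ≤ 1+ε₀/2}`), `(-Δ)^α` as the Fourier multiplier `(4π²|ξ|²)^α` in Tao's normalisation (a different constant in front of `(-Δ)^α` is absorbed by the time–amplitude rescaling `u ↦ c⁻¹u(·/c)` of the cascade class), the mild identity tested against `w ∈ H¹⁰_df` with the self-transposed propagator moved onto `w` (accepted rendering of Tao (1.15)), and the sign of `C` in the differential form is immaterial (the Duhamel display (mild) is transcribed verbatim) [cite: Coiculescu2023, §4.1 pp. 13–14]; (v) three space dimensions, `H¹⁰_df` data and solutions; the true (non-averaged) `α`-Navier–Stokes system is not asserted to blow up for any `α`.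
status: established -/
def HyperdissipativeAveragedBlowup : Prop :=
  ∀ ε₀ : ℝ, 0 < ε₀ → ε₀ < 1 → ∀ α : ℝ, 0 < α → α < 5 / 4 →
    ∃ T : L2C → L2C → L2C → ℂ, IsZeroMomentumLocalCascadeForm ε₀ T ∧
      (∀ u v w, MemH10df u → MemH10df v → MemH10df w → T u v w = T v u w) ∧
      (∀ u, MemH10df u → T u u u = 0) ∧
        ∃ u₀ : 𝓢(EuclideanSpace ℝ (Fin 3), EuclideanSpace ℝ (Fin 3)), VectorCalculus.IsDivFree ⇑u₀ ∧
          ¬ ∃ u : ℝ → L2C, IsFracMildSolutionFor α T (schwartzL2 u₀) (Ici 0) u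

/-! ### Proved consequences -/

/-- **The averaged-operator form, for every `0 < α < 5/4`** (Coiculescu 2023: Thm. 4.2 + Thm. 4.8
⇒ first clause of Cor. 4.9, "by taking `λ` near enough to `1`", p. 16): from the entry and Tao's
Theorem 3.2 (in the tree: `Tao2016.localCascade_isAveraged_holds`) there is, for every
`0 < α < 5/4`, an averaging datum `𝒜` (Tao (1.12)–(1.13)) whose form `B̃_𝒜` is symmetric on
`H¹⁰_df` with the cancellation property, and a Schwartz divergence-free `u₀`, such that
`∂ₜu = -(-Δ)^α u + B̃_𝒜(u,u)`, `u(0) = u₀` has no global mild `H¹⁰_df` solution. The proof is the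
tree's assembly of Thm. 1.5 from Thms. 3.2–3.3 (`Tao2016.averagedNS_blowup_of_cascade`) with
`e^{τΔ}` replaced by `e^{-τ(-Δ)^α}` (which also maps `H¹⁰_df` into `H¹⁰_df ⊗ ℂ`,
`memH10dfC_fracHeat`). [cite: Coiculescu2023, §4.2 Thm. 4.8 and Cor. 4.9 (p. 16)] -/
theorem HyperdissipativeAveragedBlowup.averaged (h : HyperdissipativeAveragedBlowup) {α : ℝ}
    (hα : 0 < α) (hα' : α < 5 / 4) :
    ∃ 𝒜 : AveragingDatum, 𝒜.IsSymmetric ∧ 𝒜.HasCancellation ∧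
      ∃ u₀ : 𝓢(EuclideanSpace ℝ (Fin 3), EuclideanSpace ℝ (Fin 3)), VectorCalculus.IsDivFree ⇑u₀ ∧
        ¬ ∃ u : ℝ → L2C, IsFracMildSolutionFor α 𝒜.form (schwartzL2 u₀) (Ici 0) u := by
  obtain ⟨ε₁, hε₁, h32⟩ := localCascade_isAveraged_holds
  have hε₀ : 0 < min ε₁ (1 / 2) := lt_min hε₁ (by norm_num)
  have hε₀1 : min ε₁ (1 / 2) < 1 := (min_le_right _ _).trans_lt (by norm_num)
  obtain ⟨T, hT, hsymm, hcanc, u₀, hdiv, hno⟩ := h _ hε₀ hε₀1 α hα hα'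
  obtain ⟨𝒜, h𝒜⟩ := h32 _ hε₀ (min_le_left _ _) T hT.isLocalCascadeForm
  refine ⟨𝒜, fun u v w hu hv hw => ?_, fun u hu => ?_, u₀, hdiv, ?_⟩
  · rw [h𝒜 u v w hu hv hw.memH10dfC, h𝒜 v u w hv hu hw.memH10dfC]
    exact hsymm u v w hu hv hw
  · rw [h𝒜 u u u hu hu hu.memH10dfC]
    exact hcanc u hu
  · rintro ⟨u, hu⟩
    refine hno ⟨u, hu.1, hu.2.1, fun t ht w hw => ?_⟩
    rw [hu.2.2 t ht w hw]
    congr 1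
    refine intervalIntegral.integral_congr fun s hs => ?_
    have hs0 : (0 : ℝ) ≤ s := by
      rw [Set.uIcc_of_le (show (0 : ℝ) ≤ t from ht)] at hs
      exact hs.1
    exact h𝒜 _ _ _ (hu.1 s hs0) (hu.1 s hs0) (memH10dfC_fracHeat hw.memH10dfC _ _)

/-- **Coiculescu 2023, Corollary 4.9 / Theorem 1.2, first clause, on its printed range
`3/4 < α < 5/4`:** "There exists a symmetric averaged Euler bilinear operator `B` obeying the
cancellation identity for `u ∈ H¹⁰_df(ℝ³)` and a Schwartz divergence-free initial vector field so
that there is no global-in-time solution to the associated `α`-dissipative pseudodifferential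
equation" — the restriction of `HyperdissipativeAveragedBlowup.averaged`. (The second clause,
`dim_H S_T ≤ 5 - 4α`, is not transcribed; see `scope_caveats` (ii).) [cite: Coiculescu2023, §4.2 Cor. 4.9 (p. 16) and §1 Thm. 1.2 (p. 4)] -/
theorem HyperdissipativeAveragedBlowup.corollary49 (h : HyperdissipativeAveragedBlowup) {α : ℝ}
    (hα : 3 / 4 < α) (hα' : α < 5 / 4) :
    ∃ 𝒜 : AveragingDatum, 𝒜.IsSymmetric ∧ 𝒜.HasCancellation ∧
      ∃ u₀ : 𝓢(EuclideanSpace ℝ (Fin 3), EuclideanSpace ℝ (Fin 3)), VectorCalculus.IsDivFree ⇑u₀ ∧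
        ¬ ∃ u : ℝ → L2C, IsFracMildSolutionFor α 𝒜.form (schwartzL2 u₀) (Ici 0) u :=
  h.averaged (lt_trans (by norm_num) hα) hα'

/-- **Consistency at `α = 1`: the entry returns Tao's Theorem 3.3 as stated in the tree**
(`Tao2016.localCascade_blowup`; there proved, `localCascade_blowup_holds`): a zero-momentum local
cascade form is a local cascade form, and `e^{-t(-Δ)^1} = e^{tΔ}`
(`isFracMildSolutionFor_one_iff`). [cite: Coiculescu2023, §4.1 Thms. 4.1–4.2 (p. 13)] -/
theorem HyperdissipativeAveragedBlowup.localCascade_blowup (h : HyperdissipativeAveragedBlowup) :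
    Literature.Analysis.FluidPDE.Tao2016.localCascade_blowup := by
  intro ε₀ hε₀ hε₀1
  obtain ⟨T, hT, hsymm, hcanc, u₀, hdiv, hno⟩ := h ε₀ hε₀ hε₀1 1 one_pos (by norm_num)
  refine ⟨T, hT.isLocalCascadeForm, hsymm, hcanc, u₀, hdiv, ?_⟩
  rintro ⟨u, hu⟩
  exact hno ⟨u, (isFracMildSolutionFor_one_iff T _ _ u).mpr hu⟩

/-- **Consistency at `α = 1`: the entry returns Tao's Theorem 1.5 as stated in the tree**
(`Tao2016.averagedNS_blowup`, the body of the catalogue entry `TaoAveragedBlowup`), through the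
tree's own assembly `Tao2016.averagedNS_blowup_of_cascade` (Thm. 1.5 ⇐ Thm. 3.2 + Thm. 3.3) and
the in-tree Theorem 3.2. [cite: Tao2016AveragedNS, §3 p. 14] -/
theorem HyperdissipativeAveragedBlowup.averagedNS_blowup (h : HyperdissipativeAveragedBlowup) :
    Literature.Analysis.FluidPDE.Tao2016.averagedNS_blowup :=
  averagedNS_blowup_of_cascade localCascade_isAveraged_holds h.localCascade_blowup

end Literature.Barriers.NavierStokesRegularity
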